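import Literature.NumberTheory.Transcendental.BakerQuantSetup
import HarnessLib

/-!
# Waldschmidt 1980, §3 over `ℚ` (`q = 2`): the set-up and the auxiliary functions `f_{J,τ}`, `φ_{J,τ}`

Support file (definitions and theorems only; no named facts) for the archimedean input of the
Stewart–Yu 1991 line of `Literature.Barriers.ABC.stewartYu1991_upperBound`: the binder `hW₂` of
`Literature.Barriers.ABC.stewartYu1991_of_yu1990_waldschmidt1980` is M. Waldschmidt, *A lower bound
for linear forms in logarithms*, Acta Arith. **37** (1980), Proposition 3.8, in the case `K = ℚ`,
`D = 1`, `q = 2`, `E = 2`, for a HOMOGENEOUS form `Λ = b₁ log α₁ + ⋯ + bₘ log αₘ` in logarithms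
of positive rationals satisfying the `2`-Kummer condition. Its proof is §3 of the paper
(Proposition 3.1, pp. 263–274); this file fixes the objects of §§3.2–3.4 in that special case,
following the conventions of the tree's Baker 1975, Ch. 3 files (`BakerQuantSetup.lean`), of which
Waldschmidt's §3 is a refinement ("The method of proof is that of Baker's sharpening III", p. 258).

## The special case and the conventions

* `Setup`: `n + 1 ≥ 1` positive rationals `α ⱼ ≠ 1` (`j : Fin (n+1)`; the LAST one plays the part
  of Waldschmidt's `αₙ`, the one with coefficient `βₙ = −1`) and non-zero integers `b ⱼ`. The real
  logarithms `l ⱼ = log α ⱼ`; `β r = −b_r / b_last` (`r : Fin n`) and the normalised form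
  `Λ' = ∑ᵣ βᵣ lᵣ − l_last = −Λ / b_last` (`Setup.Λ'_eq`), `Λ = ∑ⱼ bⱼ lⱼ`; here `β₀ = 0` (homogeneous).
* Unknowns `u = ((a, b), λ) : Idx h L₀ L = (Fin h × Fin (L₀+1)) × ∏ⱼ [0, Lⱼ]` — Waldschmidt's
  `(λ₋₁, λ₀, λ₁, …, λₙ)` with `0 ≤ λⱼ ≤ Lⱼ` (DIFFERENT `Lⱼ` for different `j`, (3.2) p. 264; this
  is the point of the refinement over Baker's Ch. 3, where all `Lⱼ` are equal).
* The `z₀`-polynomial of `u` is Baker's triangular `w_{a,b} = Δ(X; a) Δ(X; h)ᵇ`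
  (`BakerQuantDelta.wPoly`; Waldschmidt uses `Δ(X + λ₋₁; L₋₁ + 1)^{λ₀+1}` — only linear independence,
  sizes and denominators matter), here with RATIONAL coefficients (`wPolyQ`, `map_wPolyQ`), and at
  step `J` of the descent it is taken at the scale `c = 2^{J₀−J}`: `w_{a,b}(c X)` (`wScaled`), so
  that all evaluation points `c · s`, `c · s/2 = 2^{J₀−J−1} s` are natural numbers (the device of the
  tree's Cijsouw–Waldschmidt 1977 files; Waldschmidt evaluates `Δ(q^{−J} z + λ₋₁; …)` instead).
* Multi-orders `τ : Fin (n+1) → ℕ`: `τ 0` differentiations in `z₀` (the polynomial), `τ r.succ` in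
  the direction of the free logarithm `r : Fin n` — as `m` in `BakerQuantSetup`.
* `γ λ r = λᵣ + λ_last βᵣ ∈ ℚ`, `Acomb λ τ = ∏ᵣ γᵣ^{τᵣ}` (rational), `Alog τ = ∏ᵣ lᵣ^{τᵣ}` (the
  transcendental factor, INDEPENDENT of `u`), `ψ λ = ∑ⱼ λⱼ lⱼ`, `expo λ = ψ λ + λ_last Λ' = ∑ᵣ γᵣ lᵣ`
  (`expo_eq`).
* **The auxiliary function** (W1980 p. 268, `f_{J,τ}`):
  `F c p τ z = ∑_u p(u) · (dᵏ w_u(cX))(z)|_{k = τ 0} · Acomb · Alog τ · e^{expo(λ) z}`, and its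
  derivative `d/dz F_τ = F_{τ+e₀} + ∑ᵣ F_{τ+e_{r+1}}` (`hasDerivAt_F`; the logarithms are inside
  `Alog`, exactly as in `BakerQuantSetup.Data.hasDerivAt_F`), hence `F_τ` is entire and its
  derivatives are sums of values of other `F_τ'` (`norm_iteratedDeriv_F_le_of_forall`).
* **The algebraic twin at natural points** (W1980 p. 268, `φ_{J,τ}(s)`):
  `φ c p τ s = ∑_u p(u) · (dᵏ w_u(cX))(s) · Acomb · ∏ⱼ αⱼ^{λⱼ s} ∈ ℚ`, with
  `F c p τ s = Alog τ · (φ c p τ s + ∑_u … (e^{λ_last Λ' s} − 1))` (`F_natCast_eq`), the identity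
  behind Lemma 3.3 (`|f − φ| ≤ e^{−U/2}`).

Sizes, denominators, the interpolation step, the descent and the parameters are in the sequel
files. Nothing here is a new hypothesis: all statements are proved.

## References

* [Waldschmidt1980] M. Waldschmidt, *A lower bound for linear forms in logarithms*, Acta Arith. 37
  (1980), 257–283 — §3.2 (notations, p. 264), §3.4 (the functions `φ_{J,τ}`, `f_{J,τ}`, p. 268;
  Lemma 3.3, p. 268; the differential equations in the proof of Lemma 3.5, p. 270).
* [BakerTNT1975] A. Baker, *Transcendental Number Theory*, CUP 1975, Ch. 3 §3 (the tree's
  `BakerQuantSetup.lean`, whose design is followed here).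
-/

noncomputable section

open Complex Finset Polynomial
open Literature.NumberTheory.Transcendental.Baker1975 (bump bump_apply sum_bump)
open Literature.NumberTheory.Transcendental.Baker1975.Ch3

namespace Literature.NumberTheory.Transcendental.Waldschmidt1980

/-! ### The data -/

/-- **The data of Waldschmidt 1980, Prop. 3.1, over `ℚ` in the homogeneous case**: `n + 1`
positive rationals `αⱼ ≠ 1` and non-zero integers `bⱼ` (the linear form is `∑ bⱼ log αⱼ`; the last
index carries Waldschmidt's normalisation `βₙ = −1` after division by `−b_last`).
[cite: Waldschmidt1980, §3 (p. 263) and §3.6 (p. 275)] -/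
structure Setup where
  /-- the number of "free" logarithms; there are `n + 1` logarithms in all -/
  n : ℕ
  /-- the positive rationals `αⱼ` -/
  α : Fin (n + 1) → ℚ
  /-- positivity -/
  α_pos : ∀ j, 0 < α j
  /-- `αⱼ ≠ 1`, i.e. `log αⱼ ≠ 0` -/
  α_ne_one : ∀ j, α j ≠ 1
  /-- the integer coefficients -/
  b : Fin (n + 1) → ℤ
  /-- all coefficients are non-zero (the general case reduces to this one) -/
  b_ne : ∀ j, b j ≠ 0

/-- A box of exponents `∏ⱼ [0, Lⱼ]`. [cite: Waldschmidt1980, §3.2 (p. 264)] -/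
abbrev Box {k : ℕ} (L : Fin k → ℕ) : Type := ∀ j : Fin k, Fin (L j + 1)

/-- The index set of the unknowns `p(λ₋₁, λ₀, λ₁, …)`: `a = λ₋₁ < h`, `b = λ₀ ≤ L₀` (the
`z₀`-polynomial `Δ(X;a)Δ(X;h)ᵇ`) and the exponent vector `λ` in the box `∏ⱼ [0, Lⱼ]`.
[cite: Waldschmidt1980, §3.2–3.3 (pp. 264–266)] -/
abbrev Idx (h L₀ : ℕ) {k : ℕ} (L : Fin k → ℕ) : Type := (Fin h × Fin (L₀ + 1)) × Box L

/-- `#Idx = h (L₀+1) ∏ⱼ (Lⱼ+1)` (Waldschmidt's `(L₋₁+1)(L₀+1)⋯(Lₙ+1)`). [cite: Waldschmidt1980, (3.6) p. 264] -/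
theorem card_Idx (h L₀ : ℕ) {k : ℕ} (L : Fin k → ℕ) :
    Fintype.card (Idx h L₀ L) = h * (L₀ + 1) * ∏ j, (L j + 1) := by
  simp [Idx, Box, Fintype.card_prod, Fintype.card_pi, Fintype.card_fin]

namespace Setup

variable (S : Setup)

/-- The real logarithm `lⱼ = log αⱼ`. [cite: Waldschmidt1980, §1 (p. 257)] -/
def l (j : Fin (S.n + 1)) : ℝ := Real.log (S.α j)

/-- `lⱼ ≠ 0` (`αⱼ > 0`, `αⱼ ≠ 1`). [folklore] -/
theorem l_ne_zero (j : Fin (S.n + 1)) : S.l j ≠ 0 := by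
  have h0 : (0 : ℝ) < S.α j := by exact_mod_cast S.α_pos j
  have h1 : (S.α j : ℝ) ≠ 1 := by exact_mod_cast S.α_ne_one j
  exact Real.log_ne_zero_of_pos_of_ne_one h0 h1

/-- The normalised coefficients `βᵣ = −bᵣ / b_last` (`r < n`), so that
`Λ / (−b_last) = ∑ᵣ βᵣ lᵣ − l_last`. [cite: Waldschmidt1980, §3.6 (p. 275)] -/
def β (r : Fin S.n) : ℚ := -(S.b (Fin.castSucc r) : ℚ) / (S.b (Fin.last S.n))

/-- The linear form `Λ = ∑ⱼ bⱼ log αⱼ`. [cite: Waldschmidt1980, §1 (p. 257)] -/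
def Λ : ℝ := ∑ j, (S.b j : ℝ) * S.l j

/-- The normalised linear form `Λ' = ∑ᵣ βᵣ lᵣ − l_last` (Waldschmidt's `Λ` with `β₀ = 0`,
`βₙ = −1`). [cite: Waldschmidt1980, Prop 3.1 (p. 264)] -/
def Λ' : ℝ := ∑ r : Fin S.n, (S.β r : ℝ) * S.l (Fin.castSucc r) - S.l (Fin.last S.n)

/-- `Λ' = −Λ / b_last`. [cite: Waldschmidt1980, §3.6 (p. 275)] -/
theorem Λ'_eq : S.Λ' = -S.Λ / (S.b (Fin.last S.n)) := by
  have hb : (S.b (Fin.last S.n) : ℝ) ≠ 0 := by exact_mod_cast S.b_ne _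
  rw [eq_div_iff hb]
  unfold Λ' Λ
  rw [Fin.sum_univ_castSucc, sub_mul, Finset.sum_mul]
  have h1 : ∀ r : Fin S.n, (S.β r : ℝ) * S.l (Fin.castSucc r) * (S.b (Fin.last S.n) : ℝ) =
      -((S.b (Fin.castSucc r) : ℝ) * S.l (Fin.castSucc r)) := by
    intro r
    unfold β
    push_cast
    field_simp
  simp_rw [h1]
  rw [Finset.sum_neg_distrib]
  ring

/-- `|Λ'| · |b_last| = |Λ|`, so `|Λ'| ≤ |Λ|`. [folklore] -/
theorem abs_Λ'_le : |S.Λ'| ≤ |S.Λ| := by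
  rw [S.Λ'_eq, abs_div, abs_neg]
  have h1 : (1 : ℝ) ≤ |(S.b (Fin.last S.n) : ℝ)| := by
    rw [← Int.cast_abs]; exact_mod_cast Int.one_le_abs (S.b_ne _)
  exact div_le_self (abs_nonneg _) h1

variable {L : Fin (S.n + 1) → ℕ}

/-- `γᵣ = λᵣ + λ_last βᵣ ∈ ℚ` (p. 268: "`γⱼ = λⱼ + λₙβⱼ`"). [cite: Waldschmidt1980, §3.4 (p. 268)] -/
def γ (lam : Box L) (r : Fin S.n) : ℚ :=
  ((lam (Fin.castSucc r) : ℕ) : ℚ) + ((lam (Fin.last S.n) : ℕ) : ℚ) * S.β r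

/-- `ψ_λ = ∑ⱼ λⱼ lⱼ` (so that `e^{ψ_λ s} = ∏ⱼ αⱼ^{λⱼ s}`). [cite: Waldschmidt1980, §3.4 (p. 268)] -/
def ψ (lam : Box L) : ℝ := ∑ j, ((lam j : ℕ) : ℝ) * S.l j

/-- The exponent on the diagonal: `ψ_λ + λ_last Λ'`. [cite: Waldschmidt1980, §3.4 (p. 268)] -/
def expo (lam : Box L) : ℝ := S.ψ lam + ((lam (Fin.last S.n) : ℕ) : ℝ) * S.Λ'

/-- **The identity behind the diagonal**: `ψ_λ + λ_last Λ' = ∑ᵣ γᵣ lᵣ` (p. 268: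
`f_{J,τ} − φ_{J,τ} = ∑ p(λ) A_J α₁^{λ₁z}⋯αₙ^{λₙz}(e^{λₙΛz} − 1)`). [cite: Waldschmidt1980, §3.4 (p. 268)] -/
theorem expo_eq (lam : Box L) : S.expo lam = ∑ r : Fin S.n, (S.γ lam r : ℝ) * S.l (Fin.castSucc r) := by
  simp only [expo, ψ, Λ', γ, Fin.sum_univ_castSucc, Rat.cast_add, Rat.cast_mul, Rat.cast_natCast,
    add_mul, sum_add_distrib, mul_sum, mul_sub]
  ring_nf

/-- The rational factor `∏ᵣ γᵣ^{τᵣ}` produced by the differentiations in the directions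
`z₁, …, zₙ` (Waldschmidt's `∏ (λᵣ + λₙβᵣ)^{τᵣ}` in `A_J(z, τ)`, p. 266). [cite: Waldschmidt1980, §3.2 (p. 266)] -/
def Acomb (lam : Box L) (τ : Fin (S.n + 1) → ℕ) : ℚ := ∏ r : Fin S.n, S.γ lam r ^ τ r.succ

/-- The transcendental factor `∏ᵣ lᵣ^{τᵣ}`, independent of the unknown. [cite: Waldschmidt1980, §3.4 (p. 270)] -/
def Alog (τ : Fin (S.n + 1) → ℕ) : ℝ := ∏ r : Fin S.n, S.l (Fin.castSucc r) ^ τ r.succ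

/-- `Alog τ ≠ 0`. [folklore] -/
theorem Alog_ne_zero (τ : Fin (S.n + 1) → ℕ) : S.Alog τ ≠ 0 :=
  Finset.prod_ne_zero_iff.mpr fun _ _ => pow_ne_zero _ (S.l_ne_zero _)

/-- `Acomb (τ + e₀) = Acomb τ`. [folklore] -/
theorem Acomb_bump_zero (lam : Box L) (τ : Fin (S.n + 1) → ℕ) :
    S.Acomb lam (bump τ 0) = S.Acomb lam τ := by
  unfold Acomb
  refine prod_congr rfl fun r _ => ?_
  rw [bump_apply, if_neg (Fin.succ_ne_zero r), add_zero]

/-- `Alog (τ + e₀) = Alog τ`. [folklore] -/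
theorem Alog_bump_zero (τ : Fin (S.n + 1) → ℕ) : S.Alog (bump τ 0) = S.Alog τ := by
  unfold Alog
  refine prod_congr rfl fun r _ => ?_
  rw [bump_apply, if_neg (Fin.succ_ne_zero r), add_zero]

/-- `Acomb (τ + e_{r+1}) = Acomb τ · γᵣ`. [folklore] -/
theorem Acomb_bump_succ (lam : Box L) (τ : Fin (S.n + 1) → ℕ) (r : Fin S.n) :
    S.Acomb lam (bump τ r.succ) = S.Acomb lam τ * S.γ lam r := by
  unfold Acomb
  have h : ∀ r' : Fin S.n, S.γ lam r' ^ bump τ r.succ r'.succ =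
      S.γ lam r' ^ τ r'.succ * (if r' = r then S.γ lam r else 1) := by
    intro r'
    rw [bump_apply, pow_add]
    congr 1
    by_cases hr : r' = r
    · subst hr; simp
    · have : r'.succ ≠ r.succ := fun e => hr (Fin.succ_injective _ e)
      rw [if_neg this, if_neg hr, pow_zero]
  simp_rw [h]
  rw [prod_mul_distrib, prod_ite_eq' univ r, if_pos (mem_univ r)]

/-- `Alog (τ + e_{r+1}) = Alog τ · lᵣ`. [folklore] -/
theorem Alog_bump_succ (τ : Fin (S.n + 1) → ℕ) (r : Fin S.n) :
    S.Alog (bump τ r.succ) = S.Alog τ * S.l (Fin.castSucc r) := by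
  unfold Alog
  have h : ∀ r' : Fin S.n, S.l (Fin.castSucc r') ^ bump τ r.succ r'.succ =
      S.l (Fin.castSucc r') ^ τ r'.succ * (if r' = r then S.l (Fin.castSucc r) else 1) := by
    intro r'
    rw [bump_apply, pow_add]
    congr 1
    by_cases hr : r' = r
    · subst hr; simp
    · have : r'.succ ≠ r.succ := fun e => hr (Fin.succ_injective _ e)
      rw [if_neg this, if_neg hr, pow_zero]
  simp_rw [h]
  rw [prod_mul_distrib, prod_ite_eq' univ r, if_pos (mem_univ r)]

end Setup

/-! ### The rational `Δ`-polynomials and their scalings -/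

/-- Baker's triangular family with RATIONAL coefficients:
`wPolyQ a b h = (a! h!ᵇ)⁻¹ ∏_{slots} (X + slotVal) = Δ(X; a) Δ(X; h)ᵇ ∈ ℚ[X]`; its image in `ℂ[X]`
is `BakerQuantDelta.wPoly a b h` (`map_wPolyQ`). [cite: Waldschmidt1980, Lemma 2.4 (p. 261)] -/
def wPolyQ (a b h : ℕ) : ℚ[X] :=
  C ((wDen a b h : ℚ)⁻¹) * ∏ i : Slot a b h, (X + C ((slotVal i : ℕ) : ℚ))

/-- `wPolyQ ↦ wPoly` under `ℚ[X] → ℂ[X]`. [folklore] -/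
theorem map_wPolyQ (a b h : ℕ) : (wPolyQ a b h).map (algebraMap ℚ ℂ) = wPoly a b h := by
  unfold wPolyQ wPoly wNum
  rw [Polynomial.map_mul, Polynomial.map_C, Polynomial.map_prod]
  congr 1
  · simp
  · refine prod_congr rfl fun i _ => ?_
    rw [Polynomial.map_add, Polynomial.map_X, Polynomial.map_C]
    simp

/-- The `z₀`-polynomial at the scale `c`: `w_{a,b}(c X) ∈ ℚ[X]`. At step `J` of the descent
`c = 2^{J₀ − J}`, so that Waldschmidt's points `q^{-J} s` become the natural numbers `c s`.
[cite: Waldschmidt1980, §3.2 (p. 266, `A_J(z, τ)`)] -/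
def wScaled (c a b h : ℕ) : ℚ[X] := (wPolyQ a b h).comp (C (c : ℚ) * X)

/-- The value factor `pvQ c (a,b) k x = (dᵏ/dXᵏ w_{a,b}(cX))(x) ∈ ℚ`. [cite: Waldschmidt1980, §3.2 (p. 266)] -/
def pvQ {h L₀ : ℕ} (c : ℕ) (ab : Fin h × Fin (L₀ + 1)) (k : ℕ) (x : ℚ) : ℚ :=
  (derivative^[k] (wScaled c ab.1 ab.2 h)).eval x

/-- The same value factor as a complex polynomial function of `z`. [cite: Waldschmidt1980, §3.2 (p. 266)] -/
def pv {h L₀ : ℕ} (c : ℕ) (ab : Fin h × Fin (L₀ + 1)) (k : ℕ) (z : ℂ) : ℂ :=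
  (derivative^[k] ((wScaled c ab.1 ab.2 h).map (algebraMap ℚ ℂ))).eval z

/-- At a rational point the complex value factor is the rational one. [folklore] -/
theorem pv_ratCast {h L₀ : ℕ} (c : ℕ) (ab : Fin h × Fin (L₀ + 1)) (k : ℕ) (x : ℚ) :
    pv c ab k (x : ℂ) = (pvQ c ab k x : ℂ) := by
  unfold pv pvQ
  rw [iterate_derivative_map, Polynomial.eval_map, show ((x : ℂ)) = algebraMap ℚ ℂ x from rfl,
    Polynomial.eval₂_at_apply]
  rfl

/-- `d/dz pv_k = pv_{k+1}`. [folklore] -/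
theorem hasDerivAt_pv {h L₀ : ℕ} (c : ℕ) (ab : Fin h × Fin (L₀ + 1)) (k : ℕ) (z : ℂ) :
    HasDerivAt (pv c ab k) (pv c ab (k + 1) z) z := by
  unfold pv
  rw [Function.iterate_succ_apply']
  exact Polynomial.hasDerivAt _ z

namespace Setup

variable (S : Setup) {h L₀ : ℕ} {L : Fin (S.n + 1) → ℕ}

/-! ### The auxiliary function and its derivative -/

/-- One term of `f_{J,τ}(z)`: `(dᵏ w_u(cX))(z)|_{k=τ₀} · Acomb · Alog τ · e^{expo(λ) z}`
(Waldschmidt's `p(λ) A_J(z,τ) e^{λₙβ₀z} α₁^{γ₁z}⋯α_{n-1}^{γ_{n-1}z}` with `β₀ = 0`, the logarithms of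
the derivative factors collected in `Alog`). [cite: Waldschmidt1980, §3.4 (p. 268)] -/
def term (c : ℕ) (u : Idx h L₀ L) (τ : Fin (S.n + 1) → ℕ) (z : ℂ) : ℂ :=
  pv c u.1 (τ 0) z * ((S.Acomb u.2 τ : ℚ) : ℂ) * ((S.Alog τ : ℝ) : ℂ) * cexp ((S.expo u.2 : ℂ) * z)

/-- **The auxiliary function** `f_{J,τ}` as a function of the integer coefficients `p`, the scale
`c = 2^{J₀−J}` and the multi-order `τ`. [cite: Waldschmidt1980, §3.4 (p. 268)] -/
def F (c : ℕ) (p : Idx h L₀ L → ℤ) (τ : Fin (S.n + 1) → ℕ) (z : ℂ) : ℂ :=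
  ∑ u, (p u : ℂ) * S.term c u τ z

/-- **The derivative of one term**: `d/dz term_τ = term_{τ+e₀} + ∑ᵣ term_{τ+e_{r+1}}` (the
differential equations of p. 270). [cite: Waldschmidt1980, §3.4 (p. 270)] -/
theorem hasDerivAt_term (c : ℕ) (u : Idx h L₀ L) (τ : Fin (S.n + 1) → ℕ) (z : ℂ) :
    HasDerivAt (S.term c u τ)
      (S.term c u (bump τ 0) z + ∑ r : Fin S.n, S.term c u (bump τ r.succ) z) z := by
  set e : ℂ := (S.expo u.2 : ℂ) with he
  set K : ℂ := ((S.Acomb u.2 τ : ℚ) : ℂ) * ((S.Alog τ : ℝ) : ℂ) with hK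
  have hsplit : S.term c u τ = fun x => pv c u.1 (τ 0) x * (K * cexp (e * x)) := by
    funext x; simp only [term, hK]; ring
  rw [hsplit]
  have h1 := hasDerivAt_pv c u.1 (τ 0) z
  have h2 : HasDerivAt (fun x => K * cexp (e * x)) (K * (cexp (e * z) * e)) z := by
    have : HasDerivAt (fun x => cexp (e * x)) (cexp (e * z) * e) z := by
      have h := ((hasDerivAt_id z).const_mul e).cexp
      simpa using h
    exact this.const_mul _
  refine (h1.mul h2).congr_deriv ?_
  -- `e = ∑ γᵣ lᵣ`
  have he' : e = ∑ r : Fin S.n, ((S.γ u.2 r : ℚ) : ℂ) * ((S.l (Fin.castSucc r) : ℝ) : ℂ) := by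
    rw [he, S.expo_eq]; push_cast; rfl
  have e0 : S.term c u (bump τ 0) z = pv c u.1 (τ 0 + 1) z * (K * cexp (e * z)) := by
    simp only [term, S.Acomb_bump_zero, S.Alog_bump_zero, bump_apply, if_true, hK]; ring
  have er : ∀ r : Fin S.n, S.term c u (bump τ r.succ) z =
      pv c u.1 (τ 0) z * (K * cexp (e * z)) *
        (((S.γ u.2 r : ℚ) : ℂ) * ((S.l (Fin.castSucc r) : ℝ) : ℂ)) := by
    intro r
    simp only [term, S.Acomb_bump_succ, S.Alog_bump_succ, bump_apply,
      if_neg (Fin.succ_ne_zero r).symm, add_zero, hK]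
    push_cast; ring
  rw [e0]
  simp_rw [er]
  rw [← mul_sum, ← he']
  ring

/-- **`d/dz F_τ = ∑ᵢ F_{τ + eᵢ}`** (the logarithms being inside `Alog`, no coefficient appears).
[cite: Waldschmidt1980, §3.4 (p. 270)] -/
theorem hasDerivAt_F (c : ℕ) (p : Idx h L₀ L → ℤ) (τ : Fin (S.n + 1) → ℕ) (z : ℂ) :
    HasDerivAt (S.F c p τ) (∑ i, S.F c p (bump τ i) z) z := by
  have h : HasDerivAt (S.F c p τ) (∑ u, (p u : ℂ) *
      (S.term c u (bump τ 0) z + ∑ r : Fin S.n, S.term c u (bump τ r.succ) z)) z := by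
    unfold F
    exact HasDerivAt.fun_sum fun u _ => (S.hasDerivAt_term c u τ z).const_mul _
  refine h.congr_deriv ?_
  rw [Fin.sum_univ_succ]
  simp only [F, mul_add, sum_add_distrib, mul_sum]
  congr 1
  exact sum_comm

/-- `F_τ` is entire. [folklore] -/
theorem differentiable_F (c : ℕ) (p : Idx h L₀ L → ℤ) (τ : Fin (S.n + 1) → ℕ) :
    Differentiable ℂ (S.F c p τ) := fun z => (S.hasDerivAt_F c p τ z).differentiableAt

/-- `deriv F_τ = ∑ᵢ F_{τ+eᵢ}`. [cite: Waldschmidt1980, §3.4 (p. 270)] -/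
theorem deriv_F (c : ℕ) (p : Idx h L₀ L → ℤ) (τ : Fin (S.n + 1) → ℕ) :
    deriv (S.F c p τ) = fun z => ∑ i, S.F c p (bump τ i) z :=
  funext fun z => (S.hasDerivAt_F c p τ z).deriv

/-- **Derivatives are controlled by values** (W1980, proof of Lemma 3.5, p. 270: "we deduce from
the hypotheses that `|dᵐ/dzᵐ f_{J,τ}(s)| ≤ e^{−U/3}`"): if `|F_{τ'}(r)| ≤ ε` whenever `|τ'| ≤ T`,
then `|F_τ^{(j)}(r)| ≤ (n+1)ʲ ε` whenever `|τ| + j ≤ T`. [cite: Waldschmidt1980, Lemma 3.5 (p. 270)] -/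
theorem norm_iteratedDeriv_F_le_of_forall (c : ℕ) (p : Idx h L₀ L → ℤ) (r : ℂ) (T : ℕ) {ε : ℝ}
    (hε : ∀ τ : Fin (S.n + 1) → ℕ, ∑ i, τ i ≤ T → ‖S.F c p τ r‖ ≤ ε) :
    ∀ (j : ℕ) (τ : Fin (S.n + 1) → ℕ), (∑ i, τ i) + j ≤ T →
      ‖iteratedDeriv j (S.F c p τ) r‖ ≤ ((S.n + 1 : ℕ) : ℝ) ^ j * ε := by
  intro j
  induction j with
  | zero => intro τ hτ; simpa using hε τ (by simpa using hτ)
  | succ j ih =>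
    intro τ hτ
    rw [iteratedDeriv_succ', S.deriv_F c p τ,
      iteratedDeriv_fun_sum fun i _ => ((S.differentiable_F c p _).contDiff).contDiffAt]
    calc ‖∑ i, iteratedDeriv j (S.F c p (bump τ i)) r‖
        ≤ ∑ i, ‖iteratedDeriv j (S.F c p (bump τ i)) r‖ := norm_sum_le _ _
      _ ≤ ∑ _i : Fin (S.n + 1), ((S.n + 1 : ℕ) : ℝ) ^ j * ε := by
          refine sum_le_sum fun i _ => ih _ ?_
          rw [sum_bump]; omega
      _ = ((S.n + 1 : ℕ) : ℝ) ^ (j + 1) * ε := by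
          rw [sum_const, card_univ, Fintype.card_fin, nsmul_eq_mul, pow_succ]; push_cast; ring

/-! ### The algebraic twin at natural points and the identity of Lemma 3.3 -/

/-- The algebraic factor `∏ⱼ αⱼ^{λⱼ s} ∈ ℚ` (`= e^{ψ_λ s}`). [cite: Waldschmidt1980, §3.4 (p. 268)] -/
def αpow (lam : Box L) (s : ℕ) : ℚ := ∏ j, S.α j ^ ((lam j : ℕ) * s)

/-- `0 < ∏ⱼ αⱼ^{λⱼ s}`. [folklore] -/
theorem αpow_pos (lam : Box L) (s : ℕ) : 0 < S.αpow lam s :=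
  Finset.prod_pos fun j _ => pow_pos (S.α_pos j) _

/-- `e^{ψ_λ s} = ∏ⱼ αⱼ^{λⱼ s}`. [folklore] -/
theorem exp_ψ_mul (lam : Box L) (s : ℕ) : Real.exp (S.ψ lam * s) = (S.αpow lam s : ℝ) := by
  unfold ψ αpow
  rw [Finset.sum_mul, Real.exp_sum, Rat.cast_prod]
  refine prod_congr rfl fun j _ => ?_
  have h0 : (0 : ℝ) < S.α j := by exact_mod_cast S.α_pos j
  rw [Rat.cast_pow]
  have : ((lam j : ℕ) : ℝ) * S.l j * (s : ℝ) = (((lam j : ℕ) * s : ℕ) : ℝ) * S.l j := by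
    push_cast; ring
  rw [this, Real.exp_nat_mul]
  unfold l
  rw [Real.exp_log h0]

/-- The rational value attached to the unknown `u` at the natural point `s`:
`q_u(s) = (dᵏ w_u(cX))(s) · Acomb · ∏ⱼ αⱼ^{λⱼ s}`. [cite: Waldschmidt1980, §3.4 (p. 268)] -/
def qval (c : ℕ) (u : Idx h L₀ L) (τ : Fin (S.n + 1) → ℕ) (s : ℕ) : ℚ :=
  pvQ c u.1 (τ 0) s * S.Acomb u.2 τ * S.αpow u.2 s

/-- **The algebraic twin** `φ_{J,τ}(s) = ∑_u p(u) q_u(s) ∈ ℚ` of `f_{J,τ}(s)` at a natural point `s`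
(Waldschmidt's `φ_{J,τ}(s)`, divided by the transcendental factor `Alog τ`).
[cite: Waldschmidt1980, §3.4 (p. 268)] -/
def φ (c : ℕ) (p : Idx h L₀ L → ℤ) (τ : Fin (S.n + 1) → ℕ) (s : ℕ) : ℚ :=
  ∑ u, p u * S.qval c u τ s

/-- The perturbation factor `e^{λ_last Λ' s}` of the unknown `u` at the point `s`. [cite: Waldschmidt1980, Lemma 3.3 (p. 268)] -/
def pert (lam : Box L) (s : ℕ) : ℝ := Real.exp (((lam (Fin.last S.n) : ℕ) : ℝ) * S.Λ' * s)

/-- **One term at a natural point**: `term_u(s) = q_u(s) · Alog τ · e^{λ_last Λ' s}`.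
[cite: Waldschmidt1980, §3.4 (p. 268)] -/
theorem term_natCast (c : ℕ) (u : Idx h L₀ L) (τ : Fin (S.n + 1) → ℕ) (s : ℕ) :
    S.term c u τ (s : ℂ) =
      ((S.qval c u τ s : ℚ) : ℂ) * ((S.Alog τ : ℝ) : ℂ) * ((S.pert u.2 s : ℝ) : ℂ) := by
  unfold term qval pert
  have hpv : pv c u.1 (τ 0) (s : ℂ) = (pvQ c u.1 (τ 0) s : ℂ) := by
    have := pv_ratCast c u.1 (τ 0) (s : ℚ)
    rwa [Rat.cast_natCast] at this
  have hexp : cexp ((S.expo u.2 : ℂ) * (s : ℂ)) =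
      ((S.αpow u.2 s : ℚ) : ℂ) * ((Real.exp (((u.2 (Fin.last S.n) : ℕ) : ℝ) * S.Λ' * s) : ℝ) : ℂ) := by
    have h1 : (S.expo u.2 : ℂ) * (s : ℂ) =
        ((S.ψ u.2 * s : ℝ) : ℂ) + ((((u.2 (Fin.last S.n) : ℕ) : ℝ) * S.Λ' * s : ℝ) : ℂ) := by
      unfold expo; push_cast; ring
    rw [h1, Complex.exp_add, ← Complex.ofReal_exp, ← Complex.ofReal_exp, S.exp_ψ_mul]
    norm_cast
  rw [hpv, hexp]
  push_cast
  ring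

/-- **`f` versus `φ` at a natural point** (the identity behind Lemma 3.3, p. 268:
"`f_{J,τ}(z) − φ_{J,τ}(z) = ∑ p(λ) A_J(z,τ) α₁^{λ₁z}⋯αₙ^{λₙz}(e^{λₙΛz} − 1)`"):
`F(s) = Alog τ · (φ(s) + ∑_u p(u) q_u(s) (e^{λ_last Λ' s} − 1))`. [cite: Waldschmidt1980, Lemma 3.3 (p. 268)] -/
theorem F_natCast_eq (c : ℕ) (p : Idx h L₀ L → ℤ) (τ : Fin (S.n + 1) → ℕ) (s : ℕ) :
    S.F c p τ (s : ℂ) = ((S.Alog τ : ℝ) : ℂ) *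
      (((S.φ c p τ s : ℚ) : ℂ) +
        ∑ u, (p u : ℂ) * ((S.qval c u τ s : ℚ) : ℂ) * (((S.pert u.2 s : ℝ) : ℂ) - 1)) := by
  unfold F φ
  simp_rw [S.term_natCast]
  push_cast
  rw [mul_add, Finset.mul_sum, Finset.mul_sum, ← Finset.sum_add_distrib]
  refine Finset.sum_congr rfl fun u _ => ?_
  ring

/-- **Lemma 3.3 at a natural point, abstract form**: if `L_last |Λ'| s ≤ 1`, then
`|F(s) − Alog τ · φ(s)| ≤ |Alog τ| · (∑_u |p(u) q_u(s)|) · 2 L_last |Λ'| s`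
(from `|eʷ − 1| ≤ 2|w|` for `|w| ≤ 1`). The sequel bounds the sum by `e^{U/2}`-type quantities and
takes `|Λ'| ≤ e^{−U}`. [cite: Waldschmidt1980, Lemma 3.3 (p. 268)] -/
theorem norm_F_natCast_sub_le (c : ℕ) (p : Idx h L₀ L → ℤ) (τ : Fin (S.n + 1) → ℕ) (s : ℕ)
    (hsmall : ((L (Fin.last S.n) : ℕ) : ℝ) * |S.Λ'| * s ≤ 1) :
    ‖S.F c p τ (s : ℂ) - ((S.Alog τ : ℝ) : ℂ) * ((S.φ c p τ s : ℚ) : ℂ)‖ ≤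
      |S.Alog τ| * (∑ u, |(p u : ℝ) * (S.qval c u τ s : ℝ)|) *
        (2 * (((L (Fin.last S.n) : ℕ) : ℝ) * |S.Λ'| * s)) := by
  rw [S.F_natCast_eq, mul_add, add_sub_cancel_left, norm_mul, Complex.norm_real, Real.norm_eq_abs,
    mul_assoc]
  refine mul_le_mul_of_nonneg_left ?_ (abs_nonneg _)
  calc ‖∑ u, (p u : ℂ) * ((S.qval c u τ s : ℚ) : ℂ) * (((S.pert u.2 s : ℝ) : ℂ) - 1)‖
      ≤ ∑ u, ‖(p u : ℂ) * ((S.qval c u τ s : ℚ) : ℂ) * (((S.pert u.2 s : ℝ) : ℂ) - 1)‖ :=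
        norm_sum_le _ _
    _ ≤ ∑ u, |(p u : ℝ) * (S.qval c u τ s : ℝ)| *
          (2 * (((L (Fin.last S.n) : ℕ) : ℝ) * |S.Λ'| * s)) := by
        refine Finset.sum_le_sum fun u _ => ?_
        rw [norm_mul, norm_mul]
        have hq : ‖(p u : ℂ)‖ * ‖((S.qval c u τ s : ℚ) : ℂ)‖ = |(p u : ℝ) * (S.qval c u τ s : ℝ)| := by
          rw [abs_mul, ← Complex.ofReal_intCast, ← Complex.ofReal_ratCast, Complex.norm_real,
            Complex.norm_real, Real.norm_eq_abs, Real.norm_eq_abs]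
        rw [hq]
        refine mul_le_mul_of_nonneg_left ?_ (abs_nonneg _)
        -- `|e^w - 1| ≤ 2 |w|`, `|w| ≤ L |Λ'| s ≤ 1`
        set w : ℝ := ((u.2 (Fin.last S.n) : ℕ) : ℝ) * S.Λ' * s with hw
        have hws : |w| ≤ ((L (Fin.last S.n) : ℕ) : ℝ) * |S.Λ'| * s := by
          rw [hw, abs_mul, abs_mul, Nat.abs_cast, Nat.abs_cast]
          have hlam : ((u.2 (Fin.last S.n) : ℕ) : ℝ) ≤ ((L (Fin.last S.n) : ℕ) : ℝ) := by
            exact_mod_cast Nat.lt_succ_iff.mp (u.2 (Fin.last S.n)).isLt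
          have h0 : 0 ≤ |S.Λ'| * (s : ℝ) := by positivity
          nlinarith
        have hw1 : |w| ≤ 1 := hws.trans hsmall
        have hexp : ‖((S.pert u.2 s : ℝ) : ℂ) - 1‖ = |Real.exp w - 1| := by
          rw [← Complex.ofReal_one, ← Complex.ofReal_sub, Complex.norm_real, Real.norm_eq_abs]
          rfl
        rw [hexp]
        calc |Real.exp w - 1| ≤ 2 * |w| := Real.abs_exp_sub_one_le hw1
          _ ≤ 2 * (((L (Fin.last S.n) : ℕ) : ℝ) * |S.Λ'| * s) := by linarith
    _ = (∑ u, |(p u : ℝ) * (S.qval c u τ s : ℝ)|) *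
          (2 * (((L (Fin.last S.n) : ℕ) : ℝ) * |S.Λ'| * s)) := by
        rw [Finset.sum_mul]

/-- **If the twin vanishes, `f` is small**: `φ(s) = 0 ⇒ |F(s)| ≤ |Alog τ| (∑|p q|) · 2L|Λ'|s`.
[cite: Waldschmidt1980, Lemma 3.3 (p. 268)] -/
theorem norm_F_natCast_le_of_φ_eq_zero (c : ℕ) (p : Idx h L₀ L → ℤ) (τ : Fin (S.n + 1) → ℕ)
    (s : ℕ) (hsmall : ((L (Fin.last S.n) : ℕ) : ℝ) * |S.Λ'| * s ≤ 1) (hφ : S.φ c p τ s = 0) :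
    ‖S.F c p τ (s : ℂ)‖ ≤ |S.Alog τ| * (∑ u, |(p u : ℝ) * (S.qval c u τ s : ℝ)|) *
        (2 * (((L (Fin.last S.n) : ℕ) : ℝ) * |S.Λ'| * s)) := by
  have h := S.norm_F_natCast_sub_le c p τ s hsmall
  rwa [hφ, Rat.cast_zero, mul_zero, sub_zero] at h

/-- **If `f` is small, the twin is small**: `|Alog τ| · |φ(s)| ≤ |F(s)| + |Alog τ| (∑|p q|) · 2L|Λ'|s`.
[cite: Waldschmidt1980, Lemma 3.3 (p. 268)] -/
theorem abs_φ_le (c : ℕ) (p : Idx h L₀ L → ℤ) (τ : Fin (S.n + 1) → ℕ) (s : ℕ)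
    (hsmall : ((L (Fin.last S.n) : ℕ) : ℝ) * |S.Λ'| * s ≤ 1) :
    |S.Alog τ| * |(S.φ c p τ s : ℝ)| ≤ ‖S.F c p τ (s : ℂ)‖ +
      |S.Alog τ| * (∑ u, |(p u : ℝ) * (S.qval c u τ s : ℝ)|) *
        (2 * (((L (Fin.last S.n) : ℕ) : ℝ) * |S.Λ'| * s)) := by
  have h := S.norm_F_natCast_sub_le c p τ s hsmall
  have htri : ‖((S.Alog τ : ℝ) : ℂ) * ((S.φ c p τ s : ℚ) : ℂ)‖ ≤ ‖S.F c p τ (s : ℂ)‖ +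
      ‖S.F c p τ (s : ℂ) - ((S.Alog τ : ℝ) : ℂ) * ((S.φ c p τ s : ℚ) : ℂ)‖ := by
    have := norm_sub_le (S.F c p τ (s : ℂ))
      (S.F c p τ (s : ℂ) - ((S.Alog τ : ℝ) : ℂ) * ((S.φ c p τ s : ℚ) : ℂ))
    rwa [sub_sub_cancel] at this
  have heq : ‖((S.Alog τ : ℝ) : ℂ) * ((S.φ c p τ s : ℚ) : ℂ)‖ = |S.Alog τ| * |(S.φ c p τ s : ℝ)| := by
    rw [norm_mul, Complex.norm_real, Real.norm_eq_abs, ← Complex.ofReal_ratCast, Complex.norm_real,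
      Real.norm_eq_abs]
  rw [heq] at htri
  linarith

end Setup

end Literature.NumberTheory.Transcendental.Waldschmidt1980

end
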